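import Summits.ABC.ABC.Theses.DefiniteXi
import Literature.NumberTheory.Automorphic.BrandtSetupAdmissible
import Literature.NumberTheory.Automorphic.BrandtXiSetupIndependence
import Summits.ABC.ABC.Theorems.XiBound.Negative.XiBoundDomainSetup

/-!
# `SteinbergCore` (stmt-ABC-15024, route ABC/DefiniteXi) — negative-side lemmas I: the prime-to-6 projection and the domain

Standing-adversary (cdisprove) output for the crux `Summit.ABC.ABC.Theses.DefiniteXi.SteinbergCore`
(`∀ ε > 0 ∃ C`, `cps ξ(E;N/Nm,Nm) · ∏_{q ∣ N} v_q(Δ_min(E_(a,b))) ≤ C N^(2+ε)` for coprime `a, b` and admissible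
`Nm ∣ N`, `cps n = n / (2^{v₂ n} 3^{v₃ n})`, `ξ = brandtXi`).  Proved here (no definitions):

* `sixPart_dvd`, `one_le_primeToSix_iff`, `primeToSix_eq_ordCompl`, `primeToSix_mul`,
  `primeToSix_le_primeToSix_mul` — the projection `cps` written exactly as in the route decl is junk-free
  (`1 ≤ cps n ↔ n ≠ 0`, `cps 0 = 0`), equals `ordCompl[3] (ordCompl[2] n)` and is MULTIPLICATIVE;
* `steinbergCore_iff_nonneg_const` — WLOG `0 ≤ C`;
* `steinbergCore_iff_forall_setup` — on the whole domain a Brandt setup of type `(N/Nm, Nm)` exists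
  (`XiBound.Negative.nonempty_xiSetup_freyCurve`) and all setups compute `brandtXi`: the crux is the same bound on
  `S.xi` for EVERY setup `S`;
* `steinbergCore_iff_dropParityAndSquarefree` — the guards `Squarefree Nm`, `Odd ω(Nm)` are decorative for the
  truth of the bound (the extra instances are setup-less, value `0`): not a refutation handle;
* `not_steinbergCore_iff` — negation normal form with the inert binder `∀ (N) [NeZero N], conductorNorm = N →`
  eliminated: a refutation is ONE `ε > 0` and, for every `C`, a violating coprime pair with an admissible `Nm`.

Refuter seat refuter-cdisprove-stmt-ABC-15024-0, 2026-08-16; companion file `SteinbergCoreLocks`.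
-/

-- `Summit.<Summit>.<Problem>` is the mandated summit-side namespace; for the single-conjunct summit `ABC` the
-- duplicate `ABC.ABC` is deliberate.
set_option linter.dupNamespace false

noncomputable section

open scoped BigOperators
open Literature.NumberTheory.Automorphic Literature.NumberTheory.EllipticCurves
open Literature.NumberTheory.EllipticCurves.ModularForms
open Summit.ABC.ABC.Theses.DefiniteXi
open Summit.ABC.ABC.Theorems.XiBound.Negative (nonempty_xiSetup_freyCurve brandtXi_freyCurve_eq_xi)

namespace Summit.ABC.ABC.Theorems.SteinbergCore.Negative

/-! ## §A  The prime-to-6 projection `cps n = n / (2^{v₂ n} · 3^{v₃ n})` -/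

/-- `2^{v₂ n} · 3^{v₃ n} ∣ n`. [folklore] -/
theorem sixPart_dvd (n : ℕ) : ordProj[2] n * ordProj[3] n ∣ n := by
  rcases Nat.eq_zero_or_pos n with rfl | _
  · exact dvd_zero _
  · exact Nat.Coprime.mul_dvd_of_dvd_of_dvd
      (Nat.Coprime.pow _ _ (by norm_num : Nat.Coprime 2 3)) (Nat.ordProj_dvd n 2) (Nat.ordProj_dvd n 3)

/-- `0 < 2^{v₂ n} · 3^{v₃ n}`. [folklore] -/
theorem sixPart_pos (n : ℕ) : 0 < ordProj[2] n * ordProj[3] n := by positivity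

/-- **No junk at `ξ ≠ 0`, junk `0` at `ξ = 0`**: `1 ≤ cps n ↔ n ≠ 0` (and `cps 0 = 0 / 1 = 0`). So the LHS of the
crux vanishes exactly on the instances where `brandtXi = 0` (no setup — never on the domain, §B — or an eigen-lattice
that is not a line). [folklore] -/
theorem one_le_primeToSix_iff (n : ℕ) : 1 ≤ n / (ordProj[2] n * ordProj[3] n) ↔ n ≠ 0 := by
  rw [Nat.succ_le_iff, Nat.div_pos_iff]
  constructor
  · rintro ⟨-, h⟩ rfl
    exact absurd h (not_le.mpr (sixPart_pos 0))
  · intro h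
    exact ⟨sixPart_pos n, Nat.le_of_dvd (Nat.pos_of_ne_zero h) (sixPart_dvd n)⟩

/-- `cps 0 = 0`. [folklore] -/
theorem primeToSix_zero : (0 : ℕ) / (ordProj[2] (0 : ℕ) * ordProj[3] (0 : ℕ)) = 0 := Nat.zero_div _

/-- `cps n ≤ n`. [folklore] -/
theorem primeToSix_le (n : ℕ) : n / (ordProj[2] n * ordProj[3] n) ≤ n := Nat.div_le_self _ _

/-- `cps n = ordCompl[3] (ordCompl[2] n)` (strip the `2`-part, then the `3`-part). [folklore] -/
theorem primeToSix_eq_ordCompl (n : ℕ) :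
    n / (ordProj[2] n * ordProj[3] n) = ordCompl[3] (ordCompl[2] n) := by
  have h3 : (ordCompl[2] n).factorization 3 = n.factorization 3 := by
    rw [Nat.factorization_div (Nat.ordProj_dvd n 2)]
    simp [Nat.prime_two.factorization_pow]
  change n / (ordProj[2] n * ordProj[3] n) = n / ordProj[2] n / 3 ^ (ordCompl[2] n).factorization 3
  rw [h3, Nat.div_div_eq_div_mul]

/-- **`cps` is multiplicative**: `cps (m n) = cps m · cps n`. [folklore] -/
theorem primeToSix_mul (m n : ℕ) :
    m * n / (ordProj[2] (m * n) * ordProj[3] (m * n)) =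
      m / (ordProj[2] m * ordProj[3] m) * (n / (ordProj[2] n * ordProj[3] n)) := by
  rw [primeToSix_eq_ordCompl, primeToSix_eq_ordCompl, primeToSix_eq_ordCompl, Nat.ordCompl_mul,
    Nat.ordCompl_mul]

/-- `cps m ≤ cps (m n)` for `n ≠ 0`. [folklore] -/
theorem primeToSix_le_primeToSix_mul {m n : ℕ} (hn : n ≠ 0) :
    m / (ordProj[2] m * ordProj[3] m) ≤ m * n / (ordProj[2] (m * n) * ordProj[3] (m * n)) := by
  rw [primeToSix_mul]
  exact Nat.le_mul_of_pos_right _ ((one_le_primeToSix_iff n).mpr hn)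

/-! ## §B  Domain: setups exist, guards are decorative, normal forms -/

/-- **WLOG `0 ≤ C`.** [folklore] -/
theorem steinbergCore_iff_nonneg_const :
    SteinbergCore ↔ ∀ ε : ℝ, 0 < ε → ∃ C : ℝ, 0 ≤ C ∧ ∀ a b : ℤ, IsCoprime a b → a * b * (a + b) ≠ 0 →
      ∀ (N : ℕ) [NeZero N], (freyCurve a b).conductorNorm ℤ = N → ∀ Nm : ℕ, Odd Nm → Squarefree Nm →
      Odd Nm.primeFactors.card → Nm ∣ N →
      ((brandtXi (N / Nm) Nm (fun n => (freyCurve a b).LFunction n) /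
          (ordProj[2] (brandtXi (N / Nm) Nm (fun n => (freyCurve a b).LFunction n)) *
            ordProj[3] (brandtXi (N / Nm) Nm (fun n => (freyCurve a b).LFunction n))) : ℕ) : ℝ) *
        ((∏ q ∈ N.primeFactors, ((freyCurve a b).minimalDiscriminantNorm ℤ).factorization q : ℕ) : ℝ) ≤
        C * (N : ℝ) ^ (2 + ε) := by
  constructor
  · intro h ε hε
    obtain ⟨C, hC⟩ := h ε hε
    refine ⟨max C 0, le_max_right _ _, fun a b hab h0 N _ hN Nm h1 h2 h3 h4 => ?_⟩
    exact (hC a b hab h0 N hN Nm h1 h2 h3 h4).trans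
      (mul_le_mul_of_nonneg_right (le_max_left _ _) (Real.rpow_nonneg (Nat.cast_nonneg _) _))
  · intro h ε hε
    obtain ⟨C, -, hC⟩ := h ε hε
    exact ⟨C, hC⟩

/-- **Setup form.** On the whole domain a Brandt setup of type `(N/Nm, Nm)` exists
(`XiBound.Negative.nonempty_xiSetup_freyCurve`) and every setup computes `brandtXi`
(`Brandt.XiSetup.brandtXi_eq_xi`): the crux is equivalent to the same bound with `S.xi` for EVERY setup `S`.
Provers may fix a realisation of the Brandt module; refuters may use any. [folklore] -/
theorem steinbergCore_iff_forall_setup :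
    SteinbergCore ↔ ∀ ε : ℝ, 0 < ε → ∃ C : ℝ, ∀ a b : ℤ, IsCoprime a b → a * b * (a + b) ≠ 0 →
      ∀ (N : ℕ) [NeZero N], (freyCurve a b).conductorNorm ℤ = N → ∀ Nm : ℕ, Odd Nm → Squarefree Nm →
      Odd Nm.primeFactors.card → Nm ∣ N → ∀ S : Brandt.XiSetup (N / Nm) Nm,
      ((S.xi (fun n => (freyCurve a b).LFunction n) /
          (ordProj[2] (S.xi (fun n => (freyCurve a b).LFunction n)) *
            ordProj[3] (S.xi (fun n => (freyCurve a b).LFunction n))) : ℕ) : ℝ) *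
        ((∏ q ∈ N.primeFactors, ((freyCurve a b).minimalDiscriminantNorm ℤ).factorization q : ℕ) : ℝ) ≤
        C * (N : ℝ) ^ (2 + ε) := by
  constructor
  · intro h ε hε
    obtain ⟨C, hC⟩ := h ε hε
    refine ⟨C, fun a b hab h0 N _ hN Nm h1 h2 h3 h4 S => ?_⟩
    rw [← brandtXi_freyCurve_eq_xi S a b]
    exact hC a b hab h0 N hN Nm h1 h2 h3 h4
  · intro h ε hε
    obtain ⟨C, hC⟩ := h ε hε
    refine ⟨C, fun a b hab h0 N _ hN Nm h1 h2 h3 h4 => ?_⟩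
    subst hN
    obtain ⟨S⟩ := nonempty_xiSetup_freyCurve hab h0 h1 h2 h3 h4
    rw [brandtXi_freyCurve_eq_xi S a b]
    exact hC a b hab h0 _ rfl Nm h1 h2 h3 h4 S

/-- **The guards `Squarefree Nm`, `Odd ω(Nm)` are decorative** for the truth of the bound: without them the extra
instances have no Brandt setup (`Brandt.XiSetup.squarefree`, `Brandt.XiSetup.odd_card_primeFactors`), `brandtXi`
is the junk `0`, `cps 0 = 0` and the instance reads `0 ≤ C N^(2+ε)` (true once `C ≥ 0`).  They are NOT a
refutation handle. [folklore] -/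
theorem steinbergCore_iff_dropParityAndSquarefree :
    SteinbergCore ↔ ∀ ε : ℝ, 0 < ε → ∃ C : ℝ, ∀ a b : ℤ, IsCoprime a b → a * b * (a + b) ≠ 0 →
      ∀ (N : ℕ) [NeZero N], (freyCurve a b).conductorNorm ℤ = N → ∀ Nm : ℕ, Odd Nm → Nm ∣ N →
      ((brandtXi (N / Nm) Nm (fun n => (freyCurve a b).LFunction n) /
          (ordProj[2] (brandtXi (N / Nm) Nm (fun n => (freyCurve a b).LFunction n)) *
            ordProj[3] (brandtXi (N / Nm) Nm (fun n => (freyCurve a b).LFunction n))) : ℕ) : ℝ) *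
        ((∏ q ∈ N.primeFactors, ((freyCurve a b).minimalDiscriminantNorm ℤ).factorization q : ℕ) : ℝ) ≤
        C * (N : ℝ) ^ (2 + ε) := by
  constructor
  · intro h ε hε
    obtain ⟨C, hC0, hC⟩ := steinbergCore_iff_nonneg_const.mp h ε hε
    refine ⟨C, fun a b hab h0 N _ hN Nm h1 h4 => ?_⟩
    have hnn : (0 : ℝ) ≤ C * (N : ℝ) ^ (2 + ε) := mul_nonneg hC0 (Real.rpow_nonneg (Nat.cast_nonneg _) _)
    by_cases h2 : Squarefree Nm
    · by_cases h3 : Odd Nm.primeFactors.card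
      · exact hC a b hab h0 N hN Nm h1 h2 h3 h4
      · rw [brandtXi_of_isEmpty ⟨fun S => h3 S.odd_card_primeFactors⟩]; simpa using hnn
    · rw [brandtXi_of_isEmpty ⟨fun S => h2 S.squarefree⟩]; simpa using hnn
  · intro h ε hε
    obtain ⟨C, hC⟩ := h ε hε
    exact ⟨C, fun a b hab h0 N _ hN Nm h1 _ _ h4 => hC a b hab h0 N hN Nm h1 h4⟩

/-- **Negation normal form** (the binder `∀ (N) [NeZero N], conductorNorm = N →` is inert: `N(E) > 0`,
`conductorNorm_pos_holds`): `¬ SteinbergCore` iff for some `ε > 0` and every `C` some coprime pair and admissible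
`Nm` violate the bound. [folklore] -/
theorem not_steinbergCore_iff :
    ¬ SteinbergCore ↔ ∃ ε : ℝ, 0 < ε ∧ ∀ C : ℝ, ∃ a b : ℤ, IsCoprime a b ∧ a * b * (a + b) ≠ 0 ∧ ∃ Nm : ℕ,
      Odd Nm ∧ Squarefree Nm ∧ Odd Nm.primeFactors.card ∧ Nm ∣ (freyCurve a b).conductorNorm ℤ ∧
      C * ((freyCurve a b).conductorNorm ℤ : ℝ) ^ (2 + ε) <
        ((brandtXi ((freyCurve a b).conductorNorm ℤ / Nm) Nm (fun n => (freyCurve a b).LFunction n) /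
            (ordProj[2] (brandtXi ((freyCurve a b).conductorNorm ℤ / Nm) Nm
                (fun n => (freyCurve a b).LFunction n)) *
              ordProj[3] (brandtXi ((freyCurve a b).conductorNorm ℤ / Nm) Nm
                (fun n => (freyCurve a b).LFunction n))) : ℕ) : ℝ) *
          ((∏ q ∈ ((freyCurve a b).conductorNorm ℤ).primeFactors,
              ((freyCurve a b).minimalDiscriminantNorm ℤ).factorization q : ℕ) : ℝ) := by
  constructor
  · intro h
    by_contra hcon
    push Not at hcon
    apply h
    intro ε hε
    obtain ⟨C, hC⟩ := hcon ε hε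
    refine ⟨C, fun a b hab h0 N _ hN Nm h1 h2 h3 h4 => ?_⟩
    subst hN
    exact hC a b hab h0 Nm h1 h2 h3 h4
  · rintro ⟨ε, hε, h⟩ hSC
    obtain ⟨C, hC⟩ := hSC ε hε
    obtain ⟨a, b, hab, h0, Nm, h1, h2, h3, h4, hlt⟩ := h C
    haveI := isElliptic_freyCurve h0
    haveI : NeZero ((freyCurve a b).conductorNorm ℤ) :=
      ⟨(WeierstrassCurve.conductorNorm_pos_holds (freyCurve a b)).ne'⟩
    exact (not_le.mpr hlt) (hC a b hab h0 _ rfl Nm h1 h2 h3 h4)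


end Summit.ABC.ABC.Theorems.SteinbergCore.Negative
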